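import Summits.ValiantsHypothesis.ValiantsHypothesis.Theorems.NewtonUnitEquationsTwoProductsRankOneSchemaLawFibres
import HarnessLib

/-!
# Route NewtonUnitEquations — crux `TwoProducts` (stmt-ValiantsHypothesis-5906), line `relation_ladder`, rung R9 (the RANK-ONE
# SCHEMA law: ONE datum `(ρ⁺, ρ⁻)` of ANY shape) by the TRANSPORTATION LIFT — part 3/8 — the slice functions `F_b` on the letter box, THE COEFFICIENT THEOREM, finite shift rank (T4, T5)

THE RANK-ONE SCHEMA LAW (R9): if ALL additive coincidences of the letter family of `(u, v)` are multiples of ONE datum `(ρ⁺, ρ⁻)` —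
ANY datum `ρ⁺, ρ⁻ : Expo →₀ ℕ`, no side condition — then GLOBALLY `#visible ≤ 2^{c m}(#T + 2)^c` (`c = 1416`).  This is the rank-one SCHEMA
quantified over the datum asked for by the Negative lane (val-neg-1 g4, evidence #48 on stmt-5906, item (a)); it SUBSUMES the rungs R3♯
(`permTypeLaw_proof`), R6, R6b, R6c, R7a, R7b, R7c, R8 (each of their hypotheses exhibits a datum).  Engine = the TRANSPORTATION LIFT of
val-idea-8 g3's memo `Cruxes/TwoProducts/Lines/relation_ladder_R7_engine.md` §1 / `…R8_engine.md` §5 made uniform: for the disjoint balanced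
relation `Σ_{i ∈ P} p_i • α_i = Σ_{j ∈ N} q_j • β_j` the atoms are `Z_{ij}`, `(i, j) ∈ P × N` (upstairs index type `σ ⊕ σ × σ`: free letters on
the left, atoms on the right), `Y_{α_i} ↦ ∏_j Z_{ij}^{q_j}`, `Y_{β_j} ↦ ∏_i Z_{ij}^{p_i}`; the planar push-forward is the PRODUCT PLAN
`E'(Z_{ij})_c = (α_i)_c (β_j)_c T'_{1-c}` over the `D = T'_0 T'_1`-dilated plane (`T_c = Σ_i p_i (α_i)_c`, `T' = max(T, 1)`), the upstairs
weights are the PRODUCT PLAN `θ_{ij} = r_i r_j / R` of the letter weights (pointwise positive, NOT a pull-back; balanced because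
`Σ p_i r_i = Σ q_j r_j`); the fibre over an atom monomial is parametrised by `κ = #α_{a₀}` with a CONSISTENCY guard over all `|P|·|N|` atom
equations; SLICING by the atom exponents (≤ `2^{3m}` slices through the simplex `R8.card_W_le`); the coefficient theorem
`Pfac · C(R + B_κ − 1, B_κ) · κ_κ` and the shift rank `2m(ΣA + 1)² + 1` are shape-independent (the free letters enter only through the binomial);
`ShiftRank.pencilCount` BY NAME.  Reductions: common part of the datum (`DatumExcess.rankOne_reduce`), large / absent coefficients
(`R7a.permType_of_rankOne_largeCoeff/absent`), wide sides (`permType_of_rankOne_wideSide`), and a non-permutation coincidence balances the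
datum and makes both sides non-empty (`sides_of_shift`, over val-neg-1 g4's `OneSidedMembership.weight_*` / `DatumExcess.*`).

AUTHORSHIP / LANE NOTE (val-lit-p3 g16, prover seat, KEEP lineage, helper mode `--supports stmt-ValiantsHypothesis-5906 --as helper`;
CLAIM #1 on the val-lit bus 14:45Z 2026-08-28, ★ 15:03Z; no val-idea-8 seat alive at the time — the typed target is staged for the line
owner as `HOME/lmr/staged/p3g16-R9/sketch_R9.lean`, and the closing theorem is stated by its LITERAL BODY so that a later skeleton can wire
`stub := R9.rankOneSchemaLaw_proof` by name).  Mathematics and Lean text of this module: this seat, generalising its predecessor's R8 port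
(`…RankOneOneSidedLaw*`, val-lit-p3 g15) decl by decl.  Reused BY NAME: `R6b.HSD` (+ closure lemmas), `R7b.dilE`/`piT_dilE`/`piE_dilE`,
`R7a.choose_bridge`, `R7a.permType_of_rankOne_largeCoeff/absent`, `toolBound_mono`, `tab`, `sgn`, `R6b.sum_sgn`, `rW`/`R6b.rW_pos`, `lwt_piT`,
`PlanarCell.eq_of_nsmul_eq`/`wt_sum`, `FormalLogLinearisation.wt_nsmul`, `R8.W`/`R8.card_W_le`, `ShiftRank.pencilCount`,
`BinExpSum.pencilCount_arith`, val-neg-1 g4's `DatumExcess.*`, `RankOneCoverage.eq_of_tsub_eq_zero`, `OneSidedMembership.*`.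
Namespace `…PermutationType.R9`.  Nothing here closes the line's residual (`ResidualLawV20`), the crux `TwoProducts` (5906) or `VP ≠ VNP`;
no summit statement is proved.

Honest scope: coincidence modules of RANK ≥ 2 (val-neg-1 g4's p635223 `RankTwoEscapes`) are NOT covered; after R9 the residual of the line is
«no lattice-small permutation-type contraction (R5), no cheap class cover (R1_r), coincidence rank ≥ 2».  Nothing here moves VP ≠ VNP;
`TwoProducts` (5906) / `PlanarCellBound` stay OPEN. [folklore]

Cut table (scratch `HOME/lmr/staged/p3g16-R9/R9-Scratch.lean`, 2 249 lines, rc 0 / 0 warnings / 0 sorries, axioms standard): part 1 `…Lift` =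
T2 (`GIdx`, `P`/`N`/`rel`/`rest`, `frM` and its coordinates, `Idle`, the table sums `sum_frM_inl/inr`); part 2 `…Fibres` = T3 (`xhat`, `Lrel`,
`Lof`, `Adm`, `sA`, `KR`, `eq_Lof_of_piT`, `piT_Lof`, degrees, `Bk`, `Pfac`, `kap`, `multinomial_Lof_eq`, `coeff_phiT_frM`); part 3 `…Slice` =
T4 slice functions, THE COEFFICIENT THEOREM `coeff_free_logTrunc`, T5 finite shift rank `Fsl_shift`; part 4 `…SliceExc` = the exceptional point,
`mem_support_free_logTrunc_iff`, `Fsl_zero_zero`, `xOf`, `Fsl_congr`; part 5 `…Planar` = T7 `RelDataG`, `D`, `cell`, `enumP`, `piE_enumP_frM`,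
`phi_GT`, `injOn_of_rankOne`, `lifted_of_visible`; part 6 `…Weights` = product-plan weights `θW`, `lwt_θW_frM`, `lwt_splitG`, T8
`sliceMin_of_visible`; part 7 `…Count` = `sliceCount`, `RelDataG.count`, `permType_of_rankOne_wideSide`, `sides_of_shift`, `sum_enum_smul_eq`,
`mapDomain_enum_table`; part 8 `…Law` = arithmetic (`c = 1416`), `rankOneSchemaLaw_proof`.
-/

noncomputable section

-- Sub = Summit single-conjunct layout: the duplicated namespace component is mandated by the tree.
set_option linter.dupNamespace false
set_option linter.unusedSimpArgs false
set_option linter.unusedSectionVars false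
set_option linter.unusedVariables false

namespace Summit.ValiantsHypothesis.ValiantsHypothesis.Theorems.NewtonUnitEquations.TwoProducts.PermutationType
namespace R9
open scoped BigOperators
open MvPolynomial

variable {σ : Type*} [Fintype σ] [DecidableEq σ]

variable (Itr : GIdx σ)
/-! ## Part T4: the slice functions `F_b` (slice `b` = the atom exponents) on the LETTER box, and THE COEFFICIENT THEOREM -/

section Slice
variable {m : ℕ}

/-- The slice indicator `[ν_k = 0 for all relation letters k]`. [folklore] -/
def ind (ν : σ → ℕ) : ℂ := if (∀ k ∈ rel Itr, ν k = 0) then 1 else 0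

/-- The ADDITIVE letter-count form `λ(ν) = Σ_{free} ν_k`. [folklore] -/
def lam (ν : σ → ℕ) : ℕ := ∑ k ∈ rest Itr, ν k

/-- The exponential factor over the free letters. [folklore] -/
def restProd (t : σ → ℂ) (ν : σ → ℕ) : ℂ := ∏ k ∈ rest Itr, t k ^ ν k

/-- The admissibility guard. [folklore] -/
def gd (b : σ × σ → ℕ) (κ : ℕ) : ℂ := if Adm Itr b κ then 1 else 0

/-- The relation-letter power product of an atom on the fibre element: `∏_{k ∈ rel} t_k ^ (Lrel b κ k)`. [folklore] -/
def relProd (t : σ → ℂ) (b : σ × σ → ℕ) (κ : ℕ) : ℂ := ∏ k ∈ rel Itr, t k ^ Lrel Itr b κ k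

/-- The `ν`-independent part of the `(j, κ)` term: `[admissible] · ± (-1)^{ΣA + B_κ} ∏_{rel} t_{jk}^{Lrel} · κ_κ`. [folklore] -/
def mainConst (c d : Fin m → σ → ℂ) (b : σ × σ → ℕ) (j : Fin m ⊕ Fin m) (κ : ℕ) : ℂ :=
  gd Itr b κ * (sgn m j * (-1) ^ (sA Itr b + Bk Itr b κ) * relProd Itr (tab c d j) b κ * kap Itr b κ)

/-- The `(j, κ)` term of the slice function `F_b`: `mainConst · ∏_free t_{jk}^{ν_k} · C(λ(ν) + B_κ - 1, B_κ)`. [folklore] -/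
def mainTerm (c d : Fin m → σ → ℂ) (b : σ × σ → ℕ) (j : Fin m ⊕ Fin m) (κ : ℕ) (ν : σ → ℕ) : ℂ :=
  mainConst Itr c d b j κ * (restProd Itr (tab c d j) ν * (((lam Itr ν + (Bk Itr b κ - 1)).choose (Bk Itr b κ) : ℕ) : ℂ))

/-- The correction at the exceptional point `ν = 0` of the slice. [folklore] -/
def corr (c d : Fin m → σ → ℂ) (b : σ × σ → ℕ) (ν : σ → ℕ) : ℂ :=
  if (∀ k, ν k = 0) then ∑ j : Fin m ⊕ Fin m, ∑ κ : Fin (sA Itr b + 1), mainConst Itr c d b j κ / ((Bk Itr b κ : ℕ) : ℂ) else 0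

/-- **The slice function** `F_b` of the transportation lift of the truncated logarithm. [folklore] -/
def Fsl (c d : Fin m → σ → ℂ) (b : σ × σ → ℕ) (ν : σ → ℕ) : ℂ :=
  ind Itr ν * (∑ j : Fin m ⊕ Fin m, ∑ κ : Fin (sA Itr b + 1), mainTerm Itr c d b j κ ν) + corr Itr c d b ν

/-- `λ` at a reduced exponent is its degree. [folklore] -/
theorem lam_xhat (x : σ ⊕ σ × σ →₀ ℕ) : lam Itr ⇑(xhat Itr x) = deg (xhat Itr x) := by
  rw [deg_xhat]; unfold lam
  exact Finset.sum_congr rfl fun k hk => xhat_rest Itr x hk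

/-- The free product at a reduced exponent. [folklore] -/
theorem restProd_xhat (t : σ → ℂ) (x : σ ⊕ σ × σ →₀ ℕ) :
    restProd Itr t ⇑(xhat Itr x) = ∏ k ∈ rest Itr, t k ^ x (Sum.inl k) := by
  unfold restProd
  exact Finset.prod_congr rfl fun k hk => by rw [xhat_rest Itr x hk]

/-- Moments along the fibre. [folklore] -/
theorem mom_Lof (t : σ → ℂ) (x : σ ⊕ σ × σ →₀ ℕ) (κ : ℕ) :
    mom t (Lof Itr x κ) = relProd Itr t (fun ij => x (Sum.inr ij)) κ * restProd Itr t ⇑(xhat Itr x) := by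
  unfold mom relProd
  rw [prod_split Itr, restProd_xhat]
  have hr : ∏ k ∈ rest Itr, t k ^ (Lof Itr x κ) k = ∏ k ∈ rest Itr, t k ^ x (Sum.inl k) :=
    Finset.prod_congr rfl fun k hk => by rw [Lof_rest Itr x κ hk]
  have hb : ∏ k ∈ rel Itr, t k ^ (Lof Itr x κ) k = ∏ k ∈ rel Itr, t k ^ Lrel Itr (fun ij => x (Sum.inr ij)) κ k :=
    Finset.prod_congr rfl fun k hk => by rw [Lof_rel Itr x κ hk]
  rw [hr, hb]; ring

/-- The slice indicator at a reduced exponent is `1`. [folklore] -/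
theorem ind_xhat (x : σ ⊕ σ × σ →₀ ℕ) : ind Itr ⇑(xhat Itr x) = 1 := by
  unfold ind; rw [if_pos (fun k hk => xhat_rel Itr x hk)]

/-- The correction vanishes off the exceptional point. [folklore] -/
theorem corr_xhat (c d : Fin m → σ → ℂ) (b : σ × σ → ℕ) (x : σ ⊕ σ × σ →₀ ℕ) (h1 : 1 ≤ deg (xhat Itr x)) :
    corr Itr c d b ⇑(xhat Itr x) = 0 := by
  unfold corr
  rw [if_neg]
  intro h
  have : xhat Itr x = 0 := by ext k; exact h k
  rw [this] at h1
  simp [deg] at h1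

/-- Guard of an admissible `κ`. [folklore] -/
theorem gd_pos {b : σ × σ → ℕ} {κ : ℕ} (h : Adm Itr b κ) : gd Itr b κ = 1 := by
  unfold gd; rw [if_pos h]

/-- Guard of an inadmissible `κ`. [folklore] -/
theorem gd_neg {b : σ × σ → ℕ} {κ : ℕ} (h : ¬ Adm Itr b κ) : gd Itr b κ = 0 := by
  unfold gd; rw [if_neg h]

/-- The constants of an inadmissible `κ` vanish. [folklore] -/
theorem mainConst_eq_zero (c d : Fin m → σ → ℂ) {b : σ × σ → ℕ} {κ : ℕ} (h : ¬ Adm Itr b κ) (j : Fin m ⊕ Fin m) :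
    mainConst Itr c d b j κ = 0 := by
  unfold mainConst; rw [gd_neg Itr h, zero_mul]

/-- The atom sum of the `(·, κ)` terms at a reduced point, `κ` admissible. [folklore] -/
theorem sum_mainTerm_xhat (c d : Fin m → σ → ℂ) (x : σ ⊕ σ × σ →₀ ℕ) (h1 : 1 ≤ deg (xhat Itr x)) (κ : ℕ)
    (hκ : κ ∈ KR Itr x) :
    ∑ j, mainTerm Itr c d (fun ij => x (Sum.inr ij)) j κ ⇑(xhat Itr x) =
      (-1 : ℂ) ^ (sA Itr (fun ij => x (Sum.inr ij)) + Bk Itr (fun ij => x (Sum.inr ij)) κ) *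
        (((deg (xhat Itr x) + Bk Itr (fun ij => x (Sum.inr ij)) κ - 1).choose (Bk Itr (fun ij => x (Sum.inr ij)) κ) : ℕ) : ℂ) *
          kap Itr (fun ij => x (Sum.inr ij)) κ * (∑ j, mom (c j) (Lof Itr x κ) - ∑ j, mom (d j) (Lof Itr x κ)) := by
  have hκ' := (mem_KR Itr x κ).1 hκ
  rw [Fintype.sum_sum_type]
  simp only [mainTerm, mainConst, gd_pos Itr hκ', tab, sgn, Sum.elim_inl, Sum.elim_inr, lam_xhat,
    R7a.choose_bridge _ _ h1, mom_Lof Itr _ x κ]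
  rw [mul_sub, Finset.mul_sum, Finset.mul_sum, sub_eq_add_neg, ← Finset.sum_neg_distrib]
  congr 1
  · exact Finset.sum_congr rfl fun j _ => by ring
  · exact Finset.sum_congr rfl fun j _ => by ring

/-- The atom sum of the `(·, κ)` terms vanishes for inadmissible `κ`. [folklore] -/
theorem sum_mainTerm_xhat_zero (c d : Fin m → σ → ℂ) (x : σ ⊕ σ × σ →₀ ℕ) (κ : ℕ)
    (hκ : ¬ Adm Itr (fun ij => x (Sum.inr ij)) κ) :
    ∑ j, mainTerm Itr c d (fun ij => x (Sum.inr ij)) j κ ⇑(xhat Itr x) = 0 := by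
  refine Finset.sum_eq_zero fun j _ => ?_
  unfold mainTerm; rw [mainConst_eq_zero Itr c d hκ j, zero_mul]

/-- The slice function at a reduced point is the fibre sum. [folklore] -/
theorem Fsl_xhat_eq (c d : Fin m → σ → ℂ) (x : σ ⊕ σ × σ →₀ ℕ) (h1 : 1 ≤ deg (xhat Itr x)) :
    Fsl Itr c d (fun ij => x (Sum.inr ij)) ⇑(xhat Itr x) =
      ∑ κ ∈ KR Itr x, (-1 : ℂ) ^ (sA Itr (fun ij => x (Sum.inr ij)) + Bk Itr (fun ij => x (Sum.inr ij)) κ) *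
        (((deg (xhat Itr x) + Bk Itr (fun ij => x (Sum.inr ij)) κ - 1).choose (Bk Itr (fun ij => x (Sum.inr ij)) κ) : ℕ) : ℂ) *
          kap Itr (fun ij => x (Sum.inr ij)) κ * (∑ j, mom (c j) (Lof Itr x κ) - ∑ j, mom (d j) (Lof Itr x κ)) := by
  unfold Fsl
  rw [ind_xhat, corr_xhat Itr c d _ x h1, one_mul, add_zero, Finset.sum_comm]
  rw [Fin.sum_univ_eq_sum_range (fun κ => ∑ j, mainTerm Itr c d (fun ij => x (Sum.inr ij)) j κ ⇑(xhat Itr x))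
    (sA Itr (fun ij => x (Sum.inr ij)) + 1)]
  unfold KR
  rw [Finset.sum_filter]
  refine Finset.sum_congr rfl fun κ _ => ?_
  by_cases hκ : Adm Itr (fun ij => x (Sum.inr ij)) κ
  · rw [if_pos hκ]
    exact sum_mainTerm_xhat Itr c d x h1 κ ((mem_KR Itr x κ).2 hκ)
  · rw [if_neg hκ]
    exact sum_mainTerm_xhat_zero Itr c d x κ hκ

/-- **THE COEFFICIENT THEOREM** (slice = the atom exponents). For an idle-free `x` with `R = deg x̂ ≥ 1` and `deg x ≤ R_t`:
`coeff_x φ_frM(Λ_{R_t}) = (-1)^{deg x + 1} · Pfac(x) · F_{x|atoms}(x̂)`. [folklore] -/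
theorem coeff_free_logTrunc (c d : Fin m → σ → ℂ) (R : ℕ) (x : σ ⊕ σ × σ →₀ ℕ) (hx : Idle Itr x)
    (h1 : 1 ≤ deg (xhat Itr x)) (hR : deg x ≤ R) :
    coeff x (phiT (frM Itr) (logTrunc c d R)) =
      (-1 : ℂ) ^ (deg x + 1) * Pfac Itr x * Fsl Itr c d (fun ij => x (Sum.inr ij)) ⇑(xhat Itr x) := by
  classical
  rw [coeff_phiT_frM Itr _ x hx]
  have hdx : deg x = deg (xhat Itr x) + sA Itr (fun ij => x (Sum.inr ij)) := deg_eq_deg_xhat_add Itr x hx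
  have step2 : ∀ κ ∈ KR Itr x, coeff (Lof Itr x κ) (logTrunc c d R) =
      (-1 : ℂ) ^ (deg x + 1) * Pfac Itr x * ((-1 : ℂ) ^ (sA Itr (fun ij => x (Sum.inr ij)) + Bk Itr (fun ij => x (Sum.inr ij)) κ) *
        (((deg (xhat Itr x) + Bk Itr (fun ij => x (Sum.inr ij)) κ - 1).choose (Bk Itr (fun ij => x (Sum.inr ij)) κ) : ℕ) : ℂ) *
          kap Itr (fun ij => x (Sum.inr ij)) κ * (∑ j, mom (c j) (Lof Itr x κ) - ∑ j, mom (d j) (Lof Itr x κ))) := by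
    intro κ hκ
    have hκ' := (mem_KR Itr x κ).1 hκ
    have hdeg := deg_Lof_eq Itr x κ
    have hBle : Bk Itr (fun ij => x (Sum.inr ij)) κ ≤ sA Itr (fun ij => x (Sum.inr ij)) := Bk_le Itr hκ'
    have hdeg1 : 1 ≤ deg (Lof Itr x κ) := by omega
    have hdegR : deg (Lof Itr x κ) ≤ R := by omega
    rw [coeff_logTrunc c d R _ hdeg1 hdegR, multinomial_Lof_eq Itr x κ h1]
    have hsign : (-1 : ℂ) ^ (deg (Lof Itr x κ) + 1) =
        (-1) ^ (deg x + 1) * (-1) ^ (sA Itr (fun ij => x (Sum.inr ij)) + Bk Itr (fun ij => x (Sum.inr ij)) κ) := by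
      have e : deg x + 1 + (sA Itr (fun ij => x (Sum.inr ij)) + Bk Itr (fun ij => x (Sum.inr ij)) κ) =
          (deg (Lof Itr x κ) + 1) + 2 * sA Itr (fun ij => x (Sum.inr ij)) := by omega
      rw [← pow_add, e, pow_add (-1 : ℂ) (deg (Lof Itr x κ) + 1), pow_mul]
      norm_num
    have hn0 : ((deg (Lof Itr x κ) : ℕ) : ℂ) ≠ 0 := Nat.cast_ne_zero.mpr (by omega)
    rw [hsign]
    field_simp
  rw [Finset.sum_congr rfl step2, ← Finset.mul_sum, Fsl_xhat_eq Itr c d x h1]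

end Slice

/-! ## Part T5: finite shift rank of the slice functions (index `((Fin m ⊕ Fin m) × Fin (s+1)²) ⊕ Unit`, `s = Σ_A b`) -/

section ShiftDecomp

/-- `λ` is additive. [folklore] -/
theorem lam_add (β w : σ → ℕ) : lam Itr (β + w) = lam Itr β + lam Itr w := by
  unfold lam
  simp only [Pi.add_apply, Finset.sum_add_distrib]

/-- Binomial coefficients of the additive form `λ` have shift rank `d + 1` (Vandermonde). [folklore] -/
theorem hsd_choose (e d b₀ : ℕ) (hd : d ≤ b₀) :
    R6b.HSD (Fin (b₀ + 1)) (fun ν : σ → ℕ => (((lam Itr ν + e).choose d : ℕ) : ℂ)) := by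
  refine ⟨fun β p => if (p : ℕ) ≤ d then (((lam Itr β + e).choose p : ℕ) : ℂ) else 0,
    fun p w => (((lam Itr w).choose (d - p) : ℕ) : ℂ), fun β w => ?_⟩
  have hnat : (lam Itr β + e + lam Itr w).choose d =
      ∑ p ∈ Finset.range (d + 1), (lam Itr β + e).choose p * (lam Itr w).choose (d - p) := by
    have h := Finset.Nat.sum_antidiagonal_eq_sum_range_succ
      (fun p q => (lam Itr β + e).choose p * (lam Itr w).choose q) d
    rw [Nat.succ_eq_add_one] at h
    rw [← h, Nat.add_choose_eq]
  simp only
  rw [lam_add, show lam Itr β + lam Itr w + e = lam Itr β + e + lam Itr w by ring, hnat]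
  push_cast
  rw [Fin.sum_univ_eq_sum_range (fun p => (if p ≤ d then (((lam Itr β + e).choose p : ℕ) : ℂ) else 0) *
      (((lam Itr w).choose (d - p) : ℕ) : ℂ)) (b₀ + 1)]
  simp_rw [ite_mul, zero_mul]
  rw [← Finset.sum_filter]
  congr 1
  ext p
  simp only [Finset.mem_range, Finset.mem_filter]
  omega

/-- The free product is multiplicative. [folklore] -/
theorem restProd_add (t : σ → ℂ) (β w : σ → ℕ) : restProd Itr t (β + w) = restProd Itr t β * restProd Itr t w := by
  unfold restProd
  rw [← Finset.prod_mul_distrib]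
  exact Finset.prod_congr rfl fun j _ => by rw [Pi.add_apply, pow_add]

/-- The slice indicator is multiplicative. [folklore] -/
theorem ind_add (β w : σ → ℕ) : ind Itr (β + w) = ind Itr β * ind Itr w := by
  unfold ind
  by_cases hβ : ∀ k ∈ rel Itr, β k = 0 <;> by_cases hw : ∀ k ∈ rel Itr, w k = 0
  · rw [if_pos hβ, if_pos hw, mul_one, if_pos]
    intro k hk; rw [Pi.add_apply, hβ k hk, hw k hk]
  · rw [if_pos hβ, if_neg hw, mul_zero, if_neg]
    intro h; apply hw; intro k hk; have := h k hk; rw [Pi.add_apply] at this; omega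
  · rw [if_neg hβ, zero_mul, if_neg]
    intro h; apply hβ; intro k hk; have := h k hk; rw [Pi.add_apply] at this; omega
  · rw [if_neg hβ, zero_mul, if_neg]
    intro h; apply hβ; intro k hk; have := h k hk; rw [Pi.add_apply] at this; omega

variable {m : ℕ}

/-- The correction has shift rank one. [folklore] -/
theorem corr_hsd (c d : Fin m → σ → ℂ) (b : σ × σ → ℕ) : R6b.HSD Unit (corr Itr c d b) := by
  refine ⟨fun β _ => corr Itr c d b β, fun _ w => if (∀ k, w k = 0) then 1 else 0, fun β w => ?_⟩
  rw [Fintype.sum_unique]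
  dsimp only
  unfold corr
  by_cases hβ : ∀ k, β k = 0
  · by_cases hw : ∀ k, w k = 0
    · rw [if_pos hw, if_pos hβ, mul_one, if_pos]
      intro k; rw [Pi.add_apply, hβ k, hw k]
    · rw [if_neg hw, mul_zero, if_neg]
      intro h; apply hw; intro k; have := h k; rw [Pi.add_apply] at this; omega
  · rw [if_neg hβ, zero_mul, if_neg]
    intro h; apply hβ; intro k; have := h k; rw [Pi.add_apply] at this; omega

/-- Each `(j, κ)` term has shift rank `≤ Σ_A b + 1`. [folklore] -/
theorem mainTerm_hsd (c d : Fin m → σ → ℂ) (b : σ × σ → ℕ) (j : Fin m ⊕ Fin m) (κ : ℕ) :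
    R6b.HSD (Fin (sA Itr b + 1)) (mainTerm Itr c d b j κ) := by
  by_cases hκ : Adm Itr b κ
  · have h1 := hsd_choose Itr (Bk Itr b κ - 1) (Bk Itr b κ) (sA Itr b) (Bk_le Itr hκ)
    have h2 := R6b.HSD.homMul (restProd_add Itr (tab c d j)) h1
    have h3 := h2.constMul (mainConst Itr c d b j κ)
    unfold mainTerm
    exact h3
  · refine ⟨fun _ _ => 0, fun _ _ => 0, fun β w => ?_⟩
    unfold mainTerm
    rw [mainConst_eq_zero Itr c d hκ j, zero_mul]
    simp

/-- The slice index set for atom mass `s`. [folklore] -/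
abbrev SIdxG (m s : ℕ) := ((Fin m ⊕ Fin m) × (Fin (s + 1) × Fin (s + 1))) ⊕ Unit

/-- Its cardinality `2 m (s + 1)^2 + 1`. [folklore] -/
theorem card_SIdxG (m s : ℕ) : Fintype.card (SIdxG m s) = 2 * m * (s + 1) ^ 2 + 1 := by
  simp only [SIdxG, Fintype.card_sum, Fintype.card_prod, Fintype.card_fin, Fintype.card_unit]
  ring

/-- **Finite shift rank of the slice functions.** [folklore] -/
theorem Fsl_hsd (c d : Fin m → σ → ℂ) (b : σ × σ → ℕ) : R6b.HSD (SIdxG m (sA Itr b)) (Fsl Itr c d b) := by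
  have hmain : R6b.HSD ((Fin m ⊕ Fin m) × (Fin (sA Itr b + 1) × Fin (sA Itr b + 1)))
      (fun ν => ∑ j : Fin m ⊕ Fin m, ∑ κ : Fin (sA Itr b + 1), mainTerm Itr c d b j κ ν) :=
    R6b.HSD.sum _ fun j => R6b.HSD.sum (fun (κ : Fin (sA Itr b + 1)) ν => mainTerm Itr c d b j κ ν)
      fun κ => mainTerm_hsd Itr c d b j κ
  have h := (R6b.HSD.homMul (ind_add Itr) hmain).add (corr_hsd Itr c d b)
  unfold Fsl
  exact h

/-- The shift decomposition, unpacked. [folklore] -/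
theorem Fsl_shift (c d : Fin m → σ → ℂ) (b : σ × σ → ℕ) :
    ∃ (col : (σ → ℕ) → SIdxG m (sA Itr b) → ℂ) (ch : SIdxG m (sA Itr b) → (σ → ℕ) → ℂ),
      ∀ β w : σ → ℕ, Fsl Itr c d b (β + w) = ∑ i, col β i * ch i w :=
  Fsl_hsd Itr c d b

end ShiftDecomp

end R9
end Summit.ValiantsHypothesis.ValiantsHypothesis.Theorems.NewtonUnitEquations.TwoProducts.PermutationType

end
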